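import Summits.BirchSwinnertonDyer.BirchSwinnertonDyer.Theorems.Rank2Observatory2DescLinGens
import Literature.NumberTheory.NumberFields.CubicFieldConductor
import HarnessLib

/-!
# BirchSwinnertonDyer — rank ≥ 2 observatory: coordinate certificates for ring identities in `ℤ[θ]` (KERNEL-2DESC v2.0, S1)

HONEST FRAMING: per-curve certified theorems and census instruments; no claim on BSD in rank ≥ 2.

Generic addendum of the KERNEL-2DESC instrument (design `b2b-bsdr2-cert-3/KERNEL-2DESC.md` §12,
the RESHAPE to sharded row files). Every ring identity a per-curve 2-descent certificate needs in the
monogenic cubic order `ℤ[θ] ⊆ 𝓞 K` (`θ` a root of `X³ + aX² + bX + c`) — `F(ϑ) = 0` for the root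
`ϑ = t₀ + t₁θ + t₂θ²` of the curve cubic `F = X³ + AX² + BX + C`, the factorisation
`F′(ϑ) = u · ∏ Gⱼ^eⱼ`, `u · u⁻¹ = 1`, and a class representative `z = ∏ units · ∏ gens` — is an
identity between `ℤ`-coordinate triples computed with `MonicCubic.mulCoords` (Literature,
`CubicFieldConductor`), hence decidable by the kernel from the integer data alone. This file provides the
coordinate-side functions (`smulCoords`, `powCoords`, `prodPowCoords`, `cubicAtCoords`, `derivAtCoords`)
with their evaluation lemmas and the three bridge theorems the v2.0 checker's soundness proof uses
(`aeval_lin_eq_zero_of_coords`, `deriv_eq_of_coords`, `isUnit_lin_of_coords`), replacing the per-curve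
`linear_combination` proofs `aeval_theta` / `deriv_fac` / `prodTU` of v1.x. Sorry-free; axioms `propext`,
`Classical.choice`, `Quot.sound`. [folklore]
[cite: Cassels1991LecturesEllipticCurves, §15] [cite: CremonaAlgorithms1997, §3.6]
-/

-- single-conjunct summit: `Summit.BirchSwinnertonDyer.BirchSwinnertonDyer.…` repeats the name by design
set_option linter.dupNamespace false

open scoped NumberField

open Literature.NumberTheory.NumberFields Polynomial NumberField

namespace Summit.BirchSwinnertonDyer.BirchSwinnertonDyer.Rank2Observatory.TwoDescCubic

/-! ## Coordinate arithmetic modulo `X³ + aX² + bX + c` -/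

/-- Scalar multiple of a coordinate triple. [folklore] -/
def smulCoords (k : ℤ) (u : ℤ × ℤ × ℤ) : ℤ × ℤ × ℤ := (k * u.1, k * u.2.1, k * u.2.2)

/-- `u^n` in coordinates modulo `X³ + aX² + bX + c`. [folklore] -/
def powCoords (a b c : ℤ) (u : ℤ × ℤ × ℤ) : ℕ → ℤ × ℤ × ℤ
  | 0 => (1, 0, 0)
  | n + 1 => MonicCubic.mulCoords a b c (powCoords a b c u n) u

/-- `∏ gⱼ^eⱼ` in coordinates for a list of (coordinates, exponent). [folklore] -/
def prodPowCoords (a b c : ℤ) : List ((ℤ × ℤ × ℤ) × ℕ) → ℤ × ℤ × ℤ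
  | [] => (1, 0, 0)
  | ge :: rest => MonicCubic.mulCoords a b c (powCoords a b c ge.1 ge.2) (prodPowCoords a b c rest)

/-- `F(t) = t³ + At² + Bt + C` in coordinates. [folklore] -/
def cubicAtCoords (a b c A B C : ℤ) (t : ℤ × ℤ × ℤ) : ℤ × ℤ × ℤ :=
  powCoords a b c t 3 + smulCoords A (powCoords a b c t 2) + smulCoords B t + (C, 0, 0)

/-- `F′(t) = 3t² + 2At + B` in coordinates. [folklore] -/
def derivAtCoords (a b c A B : ℤ) (t : ℤ × ℤ × ℤ) : ℤ × ℤ × ℤ :=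
  smulCoords 3 (powCoords a b c t 2) + smulCoords (2 * A) t + (B, 0, 0)

section eval

variable {S : Type*} [CommRing S] {τ : S} {a b c : ℤ}

/-- `evalCoords` of a scalar multiple. [folklore] -/
theorem evalCoords_smulCoords (τ : S) (k : ℤ) (u : ℤ × ℤ × ℤ) :
    MonicCubic.evalCoords τ (smulCoords k u) = (k : S) * MonicCubic.evalCoords τ u := by
  simp only [MonicCubic.evalCoords, smulCoords]; push_cast; ring

/-- `evalCoords (1, 0, 0) = 1`. [folklore] -/
theorem evalCoords_one (τ : S) : MonicCubic.evalCoords τ ((1, 0, 0) : ℤ × ℤ × ℤ) = 1 := by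
  simp [MonicCubic.evalCoords]

/-- `evalCoords (C, 0, 0) = C`. [folklore] -/
theorem evalCoords_const (τ : S) (C : ℤ) : MonicCubic.evalCoords τ ((C, 0, 0) : ℤ × ℤ × ℤ) = C := by
  simp [MonicCubic.evalCoords]

/-- `evalCoords` of a coordinate power is the power (at a root of the cubic). [folklore] -/
theorem evalCoords_powCoords (hτ : τ ^ 3 + (a : S) * τ ^ 2 + (b : S) * τ + (c : S) = 0)
    (u : ℤ × ℤ × ℤ) (n : ℕ) :
    MonicCubic.evalCoords τ (powCoords a b c u n) = MonicCubic.evalCoords τ u ^ n := by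
  induction n with
  | zero => simp [powCoords, MonicCubic.evalCoords]
  | succ n ih => rw [powCoords, MonicCubic.evalCoords_mulCoords hτ, ih, pow_succ]

/-- `evalCoords` of a coordinate product of powers is the product of powers. [folklore] -/
theorem evalCoords_prodPowCoords (hτ : τ ^ 3 + (a : S) * τ ^ 2 + (b : S) * τ + (c : S) = 0)
    (l : List ((ℤ × ℤ × ℤ) × ℕ)) :
    MonicCubic.evalCoords τ (prodPowCoords a b c l) =
      (l.map fun ge => MonicCubic.evalCoords τ ge.1 ^ ge.2).prod := by
  induction l with
  | nil => simp [prodPowCoords, MonicCubic.evalCoords]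
  | cons ge rest ih =>
      rw [prodPowCoords, MonicCubic.evalCoords_mulCoords hτ, evalCoords_powCoords hτ, ih,
        List.map_cons, List.prod_cons]

/-- `evalCoords (F(t)) = F(evalCoords t)`. [folklore] -/
theorem evalCoords_cubicAtCoords (hτ : τ ^ 3 + (a : S) * τ ^ 2 + (b : S) * τ + (c : S) = 0)
    (A B C : ℤ) (t : ℤ × ℤ × ℤ) :
    MonicCubic.evalCoords τ (cubicAtCoords a b c A B C t) =
      MonicCubic.evalCoords τ t ^ 3 + (A : S) * MonicCubic.evalCoords τ t ^ 2 +
        (B : S) * MonicCubic.evalCoords τ t + (C : S) := by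
  simp only [cubicAtCoords, MonicCubic.evalCoords_add, evalCoords_smulCoords, evalCoords_powCoords hτ,
    evalCoords_const]

/-- `evalCoords (F′(t)) = F′(evalCoords t)`. [folklore] -/
theorem evalCoords_derivAtCoords (hτ : τ ^ 3 + (a : S) * τ ^ 2 + (b : S) * τ + (c : S) = 0)
    (A B : ℤ) (t : ℤ × ℤ × ℤ) :
    MonicCubic.evalCoords τ (derivAtCoords a b c A B t) =
      3 * MonicCubic.evalCoords τ t ^ 2 + 2 * (A : S) * MonicCubic.evalCoords τ t + (B : S) := by
  simp only [derivAtCoords, MonicCubic.evalCoords_add, evalCoords_smulCoords, evalCoords_powCoords hτ,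
    evalCoords_const]
  push_cast; ring

end eval

/-! ## Bridge theorems in `𝓞 K` -/

variable {K : Type*} [Field K] [NumberField K] {a b c : ℤ} {θ : K}

omit [NumberField K] in
/-- `lin hθ c₀ c₁ c₂` is the evaluation of the coordinate triple at `thetaInt hθ`. [folklore] -/
theorem lin_eq_evalCoords (hθ : aeval θ (MonicCubic.poly a b c) = 0) (t : ℤ × ℤ × ℤ) :
    lin hθ t.1 t.2.1 t.2.2 = MonicCubic.evalCoords (MonicCubic.thetaInt hθ) t := by
  simp only [lin, MonicCubic.evalCoords]

/-- **`F(ϑ) = 0`** for `ϑ = t₀ + t₁θ + t₂θ²` from the coordinate identity `cubicAtCoords … t = 0`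
(decidable by the kernel). [folklore] -/
theorem aeval_lin_eq_zero_of_coords (hθ : aeval θ (MonicCubic.poly a b c) = 0) {A B C : ℤ}
    (t : ℤ × ℤ × ℤ) (h : cubicAtCoords a b c A B C t = (0, 0, 0)) :
    aeval (algebraMap (𝓞 K) K (lin hθ t.1 t.2.1 t.2.2)) (MonicCubic.poly A B C) = 0 := by
  rw [aeval_algebraMap_apply]
  have h1 : aeval (lin hθ t.1 t.2.1 t.2.2 : 𝓞 K) (MonicCubic.poly A B C) = 0 := by
    have e := evalCoords_cubicAtCoords (S := 𝓞 K) (MonicCubic.thetaInt_rel hθ) A B C t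
    have e0 : MonicCubic.evalCoords (MonicCubic.thetaInt hθ) (((0 : ℤ), (0 : ℤ), (0 : ℤ)) : ℤ × ℤ × ℤ) = 0 := by
      simp [MonicCubic.evalCoords]
    rw [h, e0, ← lin_eq_evalCoords] at e
    simp only [MonicCubic.poly, map_add, map_mul, map_pow, aeval_X, eq_intCast, map_intCast]
    linear_combination -e
  rw [h1, map_zero]

/-- **`F′(ϑ) = u · ∏ⱼ Gⱼ^eⱼ`** (list form) from the coordinate identity
`derivAtCoords … t = mulCoords u (prodPowCoords gens)`. [folklore] -/
theorem deriv_eq_of_coords (hθ : aeval θ (MonicCubic.poly a b c) = 0) {A B : ℤ} (t u : ℤ × ℤ × ℤ)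
    (l : List ((ℤ × ℤ × ℤ) × ℕ))
    (h : derivAtCoords a b c A B t = MonicCubic.mulCoords a b c u (prodPowCoords a b c l)) :
    (3 : 𝓞 K) * (lin hθ t.1 t.2.1 t.2.2) ^ 2 + 2 * ((A : ℤ) : 𝓞 K) * (lin hθ t.1 t.2.1 t.2.2) + ((B : ℤ) : 𝓞 K) =
      lin hθ u.1 u.2.1 u.2.2 * (l.map fun ge => (lin hθ ge.1.1 ge.1.2.1 ge.1.2.2) ^ ge.2).prod := by
  have hτ := MonicCubic.thetaInt_rel hθ
  have e := congrArg (MonicCubic.evalCoords (MonicCubic.thetaInt hθ)) h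
  rw [evalCoords_derivAtCoords hτ, MonicCubic.evalCoords_mulCoords hτ, evalCoords_prodPowCoords hτ] at e
  simp only [lin_eq_evalCoords]
  convert e using 3

/-- **`u` is a unit** from the coordinate identity `mulCoords u v = 1`. [folklore] -/
theorem isUnit_lin_of_coords (hθ : aeval θ (MonicCubic.poly a b c) = 0) (u v : ℤ × ℤ × ℤ)
    (h : MonicCubic.mulCoords a b c u v = (1, 0, 0)) : IsUnit (lin hθ u.1 u.2.1 u.2.2) := by
  refine isUnit_lin hθ u.1 u.2.1 u.2.2 v.1 v.2.1 v.2.2 ?_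
  have e := congrArg (MonicCubic.evalCoords (MonicCubic.thetaInt hθ)) h
  rw [MonicCubic.evalCoords_mulCoords (MonicCubic.thetaInt_rel hθ), evalCoords_one] at e
  simpa only [lin_eq_evalCoords] using e

/-- **A product of elements given by coordinates** equals the element with the product coordinates
(class representatives `z = ∏ units(T) · ∏ gens(U)` of the kill step). [folklore] -/
theorem list_prod_lin_eq_of_coords (hθ : aeval θ (MonicCubic.poly a b c) = 0)
    (l : List (ℤ × ℤ × ℤ)) :
    (l.map fun g => lin hθ g.1 g.2.1 g.2.2).prod =
      lin hθ (prodPowCoords a b c (l.map fun g => (g, 1))).1 (prodPowCoords a b c (l.map fun g => (g, 1))).2.1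
        (prodPowCoords a b c (l.map fun g => (g, 1))).2.2 := by
  rw [lin_eq_evalCoords, evalCoords_prodPowCoords (MonicCubic.thetaInt_rel hθ)]
  simp only [List.map_map, Function.comp_def, pow_one, lin_eq_evalCoords]

/-! ## Kernel sanity checks on census data (curve `10120g1` over `ℚ(α)`, `α³ = α + 1`) -/

/-- `F(θ) = 0` for `10120g1`: `θ = 12 − 31α − 18α²`, `F = X³ − 2743X + 56767`. [folklore] -/
example : cubicAtCoords 0 (-1) (-1) 0 (-2743) 56767 (12, -31, -18) = (0, 0, 0) := by decide +kernel

/-- `F′(θ) = u·g₅·g₁₁²·g₂₃³` for `10120g1`. [folklore] -/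
example : derivAtCoords 0 (-1) (-1) 0 (-2743) (12, -31, -18) =
    MonicCubic.mulCoords 0 (-1) (-1) (0, -1, -1)
      (prodPowCoords 0 (-1) (-1) [((-1, 1, -2), 1), ((5, 4, -3), 2), ((1, 3, -1), 3)]) := by decide +kernel

/-- `u·(1 − α) = 1`. [folklore] -/
example : MonicCubic.mulCoords 0 (-1) (-1) (0, -1, -1) (1, -1, 0) = (1, 0, 0) := by decide +kernel

end Summit.BirchSwinnertonDyer.BirchSwinnertonDyer.Rank2Observatory.TwoDescCubic
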